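import Literature.AlgebraicGeometry.Resolution.ArithmeticalThreefoldsCompletionValues
import HarnessLib

/-!
# Values on models of `Spec Â` that are isomorphisms above `Spec Â_g`, `g ∈ A`

Topic: `Literature/AlgebraicGeometry/Resolution` (proofs only; no new notions, no new named
facts). Continuation of `ArithmeticalThreefoldsCompletionValues.lean` (values of the formal
completion under an extension `v̂` of a rank-one dominating valuation `v`). In Cossart–Piltant's
descent (J. Algebra 529 (2019) = arXiv:1412.0868, proof of journal Prop. 4.8 = v1 Prop. 4.6,
p. 53) the resolution `π̂ : Ŷ → Spec Â` is an isomorphism above `Spec Â_g` for some `0 ≠ g ∈ A`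
(Thm. 1.1 (ii) and `Sing 𝒳̂ = f⁻¹(Sing 𝒳)`), so the local rings of `Ŷ` lie in `Â[1/g]`: their
elements have `K`-FINITE denominators, and the archimedean comparabilities needed by the `E = F`
loop of Lemma 4.7 (= [CoP1] Prop. 8.1, stated for rank-one valuations) hold for them although
`v̂` may have higher rank ("it is not necessary to assume here that `dim 𝒪_v̂ = 1` because
`h ∈ A`"):

* `exists_pow_valuation_le_of_mul_pow_eq` — for `y ∈ Â[1/g]` with `v̂(y) > 0` and `c ∈ K^×`, some
  power of `v̂(y)` passes `v(c)`;
* `exists_pow_valuation_le_of_mem_locAtCentre_of_finite_denominators` — the same on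
  `locAtCentre C O'` for any subring `C` of `K`-finite-denominator fractions (the `harchC` input of
  the rank-free `E = F` engines).

## Sources

* V. Cossart, O. Piltant, J. Algebra 529 (2019) 268–535 = arXiv:1412.0868, proof of Prop. 4.8
  with Lemma 4.7 (arXiv v1: Prop. 4.6, p. 53). [CossartPiltant2019]
* V. Cossart, O. Piltant, J. Algebra 320 (2008) 1051–1082, proof of Prop. 8.1. [CossartPiltant2008]
-/

noncomputable section

namespace Literature.AlgebraicGeometry.Resolution

universe u v w

open IsLocalRing

variable {A : Type u} [CommRing A] [IsLocalRing A] [IsNoetherianRing A]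
  {K : Type v} [Field K] [Algebra A K]

/-- **Comparability on a model that is an isomorphism over `D(g)`, `g ∈ A`.** In the situation of
`valuation_adicCompletion_eq_or_lt`, let `0 ≠ g ∈ A` (non-zero in `K`) and let `y ∈ K̂₁` lie in
`Â[1/g]`, i.e. `y · g^N = x` for some `x ∈ Â` — as every element of the local rings of a model
`Ŷ → Spec Â` which is an isomorphism above `Spec Â_g` does (Cossart–Piltant: "there exists
`g ∈ A`, `g ≠ 0` such that `π̂` is an isomorphism above `𝒳̂_g`"). If `v̂(y) > 0` then for every
`c ∈ K^×` some power of `v̂(y)` passes `v(c)`: the denominator `g^N` is `K`-finite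
(`exists_pow_valuation_div_le_of_finite_denominator`). This is the input of the `E = F` loop of
Lemma 4.7 (= [CoP1] Prop. 8.1) for the exceptional parameters of such models.
[cite: CossartPiltant2019, proof of Prop. 4.8 with Lemma 4.7 (arXiv v1: Prop. 4.6, p. 53)]
[cite: CossartPiltant2008, proof of Prop. 8.1 (HAL p. 23)] -/
theorem exists_pow_valuation_le_of_mul_pow_eq (O : ValuationSubring K)
    (hrk : Nonempty O.valuation.RankOne) (hAO : ∀ x : A, algebraMap A K x ∈ O)
    (hdom : ∀ x ∈ maximalIdeal A, O.valuation (algebraMap A K x) < 1)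
    {K₁ : Type w} [Field K₁] [Algebra (AdicCompletion (maximalIdeal A) A) K₁]
    (ι : K →+* K₁) (hι : ι.comp (algebraMap A K) =
      (algebraMap (AdicCompletion (maximalIdeal A) A) K₁).comp
        (algebraMap A (AdicCompletion (maximalIdeal A) A)))
    (O' : ValuationSubring K₁)
    (hRO' : ∀ x : AdicCompletion (maximalIdeal A) A, algebraMap _ K₁ x ∈ O')
    (hO : O'.comap ι = O) {g : A} (hg : algebraMap A K g ≠ 0) {y : K₁}
    (hyg : ∃ (x : AdicCompletion (maximalIdeal A) A) (N : ℕ),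
      y * algebraMap _ K₁ (algebraMap A (AdicCompletion (maximalIdeal A) A) g) ^ N =
        algebraMap _ K₁ x)
    (hy : O'.valuation y < 1) (c : K) (hc : c ≠ 0) :
    ∃ n : ℕ, O'.valuation y ^ n ≤ O'.valuation (ι c) := by
  have hιA : ∀ a : A, algebraMap (AdicCompletion (maximalIdeal A) A) K₁
      (algebraMap A (AdicCompletion (maximalIdeal A) A) a) = ι (algebraMap A K a) := fun a => by
    have := RingHom.congr_fun hι a
    simpa only [RingHom.comp_apply] using this.symm
  obtain ⟨x, N, hx⟩ := hyg
  have hgN : algebraMap (AdicCompletion (maximalIdeal A) A) K₁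
      (algebraMap A (AdicCompletion (maximalIdeal A) A) g ^ N) = ι (algebraMap A K g ^ N) := by
    rw [map_pow, map_pow, hιA]
  have hne : algebraMap (AdicCompletion (maximalIdeal A) A) K₁
      (algebraMap A (AdicCompletion (maximalIdeal A) A) g ^ N) ≠ 0 := by
    rw [hgN]
    exact (map_ne_zero ι).mpr (pow_ne_zero N hg)
  have hyeq : y = algebraMap _ K₁ x /
      algebraMap _ K₁ (algebraMap A (AdicCompletion (maximalIdeal A) A) g ^ N) := by
    rw [eq_div_iff hne, ← hx, map_pow]
  rw [hyeq] at hy ⊢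
  refine exists_pow_valuation_div_le_of_finite_denominator O hrk hAO hdom ι hι O' hRO' hO x _
    ⟨algebraMap A K g ^ N, pow_ne_zero N hg, ?_⟩ hy c hc
  rw [hgN]


/-- **Comparability on the ring of `K`-finite-denominator fractions, localized at `v̂`-units** —
the archimedean input `harchC` of the rank-free `E = F` engines
(`MonoidalEFReductionWithin.lean`, `MonoidalEFReductionTrackedWithin.lean`,
`Prop81MiddleAssemblyWithin.lean`) for Cossart–Piltant's Lemma 4.7 at the higher-rank extension
`v̂`. Let `C` be any subring of `K̂₁` all of whose elements are fractions `x/e`, `x, e ∈ Â`, with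
`e` `K`-FINITE (`v̂(e) ≤ v(b)` for some `b ∈ K^×`) — e.g. `T⁻¹Â` for `T` the `K`-finite elements,
which contains the local rings of a model of `Spec Â` that is an isomorphism above `Spec Â_g`,
`0 ≠ g ∈ A`, at the centre of `v̂` (the centre of the coarsening of `v̂` by the finite values lies
over `Spec Â_g` and generalizes the centre of `v̂`). Then every `y ∈ locAtCentre C O'` with
`v̂(y) > 0` satisfies `n·v̂(y) ≥ v(c)` for every `c ∈ K^×` and some `n`: `y = (x₁/e₁)/(x₂/e₂)` with
`v̂(x₂/e₂) = 0`, so `y = (x₁e₂)/(e₁x₂)` with `e₁x₂` `K`-finite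
(`exists_pow_valuation_div_le_of_finite_denominator`).
[cite: CossartPiltant2019, proof of Prop. 4.8 with Lemma 4.7 (arXiv v1: Prop. 4.6, p. 53)]
[cite: CossartPiltant2008, proof of Prop. 8.1 (HAL p. 23)] -/
theorem exists_pow_valuation_le_of_mem_locAtCentre_of_finite_denominators
    (O : ValuationSubring K) (hrk : Nonempty O.valuation.RankOne)
    (hAO : ∀ x : A, algebraMap A K x ∈ O)
    (hdom : ∀ x ∈ maximalIdeal A, O.valuation (algebraMap A K x) < 1)
    {K₁ : Type w} [Field K₁] [Algebra (AdicCompletion (maximalIdeal A) A) K₁]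
    (ι : K →+* K₁) (hι : ι.comp (algebraMap A K) =
      (algebraMap (AdicCompletion (maximalIdeal A) A) K₁).comp
        (algebraMap A (AdicCompletion (maximalIdeal A) A)))
    (O' : ValuationSubring K₁)
    (hRO' : ∀ x : AdicCompletion (maximalIdeal A) A, algebraMap _ K₁ x ∈ O')
    (hO : O'.comap ι = O) (C : Subring K₁)
    (hC : ∀ y ∈ C, ∃ x e : AdicCompletion (maximalIdeal A) A,
      (∃ b : K, b ≠ 0 ∧ O'.valuation (ι b) ≤ O'.valuation (algebraMap _ K₁ e)) ∧
        y * algebraMap _ K₁ e = algebraMap _ K₁ x)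
    {y : K₁} (hy : y ∈ locAtCentre C O') (hvy : O'.valuation y < 1) (c : K) (hc : c ≠ 0) :
    ∃ n : ℕ, O'.valuation y ^ n ≤ O'.valuation (ι c) := by
  obtain ⟨y₁, hy₁, y₂, hy₂, hv₂, rfl⟩ := hy
  obtain ⟨x₁, e₁, ⟨b₁, hb₁, hbe₁⟩, h₁⟩ := hC y₁ hy₁
  obtain ⟨x₂, e₂, ⟨b₂, hb₂, hbe₂⟩, h₂⟩ := hC y₂ hy₂
  have hpos : ∀ b : K, b ≠ 0 → 0 < O'.valuation (ι b) := fun b hb =>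
    zero_lt_iff.mpr ((Valuation.ne_zero_iff _).mpr ((map_ne_zero ι).mpr hb))
  have he₁ : algebraMap (AdicCompletion (maximalIdeal A) A) K₁ e₁ ≠ 0 := fun h0 => by
    rw [h0, map_zero] at hbe₁; exact not_lt.mpr hbe₁ (hpos b₁ hb₁)
  have he₂ : algebraMap (AdicCompletion (maximalIdeal A) A) K₁ e₂ ≠ 0 := fun h0 => by
    rw [h0, map_zero] at hbe₂; exact not_lt.mpr hbe₂ (hpos b₂ hb₂)
  have hy₂0 : y₂ ≠ 0 := ne_zero_of_valuation_eq_one hv₂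
  -- `y₁ / y₂ = (x₁ e₂) / (e₁ x₂)` with `e₁ x₂` `K`-finite
  have hx₂val : O'.valuation (algebraMap _ K₁ x₂) =
      O'.valuation (algebraMap (AdicCompletion (maximalIdeal A) A) K₁ e₂) := by
    rw [← h₂, map_mul, hv₂, one_mul]
  have hfin : ∃ b : K, b ≠ 0 ∧ O'.valuation (ι b) ≤
      O'.valuation (algebraMap (AdicCompletion (maximalIdeal A) A) K₁ (e₁ * x₂)) :=
    ⟨b₁ * b₂, mul_ne_zero hb₁ hb₂, by
      rw [map_mul, map_mul, map_mul, map_mul, hx₂val]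
      exact mul_le_mul' hbe₁ hbe₂⟩
  have heq : y₁ / y₂ = algebraMap _ K₁ (x₁ * e₂) /
      algebraMap (AdicCompletion (maximalIdeal A) A) K₁ (e₁ * x₂) := by
    have hx₂0 : algebraMap (AdicCompletion (maximalIdeal A) A) K₁ x₂ ≠ 0 := by
      rw [← h₂]; exact mul_ne_zero hy₂0 he₂
    rw [map_mul, map_mul, ← h₁, ← h₂]
    field_simp
  rw [heq] at hvy ⊢
  exact exists_pow_valuation_div_le_of_finite_denominator O hrk hAO hdom ι hι O' hRO' hO
    (x₁ * e₂) (e₁ * x₂) hfin hvy c hc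

end Literature.AlgebraicGeometry.Resolution

end
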